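import Summits.CriticalPhenomena.CardyFormulaZ2.Theorems.CardyBoundaryCoulombGasStripClusterRatesConfinedGlueTransfer
import HarnessLib

/-!
# Modulo end separation, the PLAIN two-sided Cardy-order statement suffices for `n·γ₂(n) → 2π`

Support file for line `two-cluster-rate-is-stationary-gap` (crux `StripClusterRates`,
stmt-CriticalPhenomena-13878), lead c8, stub `c8_kacTwo_of_sep_plain` (T6d, "modulo SEP, the PLAIN two-sided
Cardy-order statement suffices for K₂").

Let `f(M,b)` be the probability (bond percolation on `ℤ²` at `p = 1/2`) of the END-CONFINED block event on
`[0,M]×[0,3b+2]` of lead c6's `…ConfinedGlueTransfer` (two end-confined open long crossings with their fences and an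
end-confined dual-open long face crossing in between), `p₂(m,n)` the probability of the PLAIN two-cluster event (two
open LR crossings of `[0,m]×[0,n]` in distinct open clusters of the rectangle), and `γ₂ : ℕ → ℝ` any family of
two-cluster rates in TRANSFER-MATRIX order (`−log p₂(m,n)/m → γ₂(n)` for every width `n ≥ 1`). Lead c6's landed
ORDER TRANSFER `tendsto_nMul_rateTwo_of_cardyOrderTwo` derives the Kac limit `n·γ₂(n) → 2π` from the two-sided
Cardy-order statement CO₂ = (PLAIN upper bound PU: `p₂(A·n, n) ≤ e^{−g(A)}` eventually in `n`, `g(A)/A → 2π`) ∧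
(CONFINED lower bound CL: `e^{−G(A)} ≤ f(A(3b+2), b)` eventually in `b`, `G(A)/A → 2π`).

This file shows that MODULO the end-separation hypothesis SEP (`c·p₂(M, 3b+2) ≤ f(M + k(3b+2), b)` for `b ≥ b₀`,
`M ≥ 1`, with an absolute `c > 0` and a fixed `k ≥ 1`: a plain two-cluster crossing is upgraded to an end-confined
one `k` widths longer at bounded cost) and the a-priori Cardy-order lower bound APL for the confined event
(`e^{−C·A} ≤ f(A(3b+2), b)` for `A ≥ 1`, `b ≥ 2`), the PLAIN lower bound PL (`e^{−G(A)} ≤ p₂(A·n, n)` eventually in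
`n`, `G(A)/A → 2π`) already gives CL; hence PU ∧ PL imply `n·γ₂(n) → 2π` for every family of two-cluster rates:

* `ksp_confinedLower_of_sep_plain`: CL holds with the exponent `G'(A) := C·A` for `A ≤ k` (APL) and
  `G'(A) := G(A−k) − log c` for `A > k` (SEP at `M = (A−k)(3b+2)`, then PL at aspect ratio `A−k ≥ 1` along the
  widths `n = 3b+2 → ∞`), and `G'(A)/A → 2π` (`ksp_tendsto_shift_div`: `G(A−k)/(A−k) → 2π`, `(A−k)/A → 1`,
  `(log c)/A → 0`);
* `c8_kacTwo_of_sep_plain`: the registered form — `tendsto_nMul_rateTwo_of_cardyOrderTwo ⟨PU, CL⟩`.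

No definitions; `pTwo`, `rateSeqTwo` are the abbreviations of `Negative.KacFromAboveFalse` (the plain two-cluster
event and the rate sequence of the crux, which c6's transfer takes verbatim — the conversion is definitional).

References: [Cardy1998] eq. (bb); [Nolin2008] §4 (separation of arms).
-/

noncomputable section

open MeasureTheory Filter Topology Set
open Literature.Probability.LatticeModels Literature.Probability.Percolation
open Summit.CriticalPhenomena.CardyFormulaZ2.Theorems.StripClusterRates.Negative (pOne pTwo rateSeqTwo rateSeqOne)

namespace Summit.CriticalPhenomena.CardyFormulaZ2.Cruxes.StripClusterRates.TwoClusterRateIsStationaryGap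

/-! ## §1 The shifted exponent `G(A−k) − log c` is still of Cardy order `2π·A` -/

/-- `↑(A − k)/↑A → 1` along `A → ∞` (truncated subtraction, fixed `k : ℕ`). [folklore] -/
theorem ksp_tendsto_natSub_div (k : ℕ) :
    Tendsto (fun A : ℕ ↦ ((A - k : ℕ) : ℝ) / (A : ℝ)) atTop (𝓝 1) := by
  have h : Tendsto (fun A : ℕ ↦ 1 - (k : ℝ) / (A : ℝ)) atTop (𝓝 (1 - 0)) :=
    tendsto_const_nhds.sub (tendsto_const_nhds.div_atTop tendsto_natCast_atTop_atTop)
  rw [sub_zero] at h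
  refine h.congr' ?_
  filter_upwards [eventually_gt_atTop k] with A hA
  have hA0 : (A : ℝ) ≠ 0 := Nat.cast_ne_zero.2 (by omega)
  rw [Nat.cast_sub hA.le, sub_div, div_self hA0]

/-- If `G(A)/A → 2π` then `(G(A−k) − κ)/A → 2π` for every fixed shift `k : ℕ` and constant `κ : ℝ`. [folklore] -/
theorem ksp_tendsto_shift_div {G : ℕ → ℝ} (hG : Tendsto (fun A : ℕ ↦ G A / A) atTop (𝓝 (2 * Real.pi)))
    (k : ℕ) (κ : ℝ) :
    Tendsto (fun A : ℕ ↦ (G (A - k) - κ) / A) atTop (𝓝 (2 * Real.pi)) := by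
  have h1 : Tendsto (fun A : ℕ ↦ G (A - k) / ((A - k : ℕ) : ℝ)) atTop (𝓝 (2 * Real.pi)) :=
    hG.comp (tendsto_sub_atTop_nat k)
  have h3 : Tendsto (fun A : ℕ ↦ κ / (A : ℝ)) atTop (𝓝 0) :=
    tendsto_const_nhds.div_atTop tendsto_natCast_atTop_atTop
  have h := (h1.mul (ksp_tendsto_natSub_div k)).sub h3
  rw [mul_one, sub_zero] at h
  refine h.congr' ?_
  filter_upwards [eventually_gt_atTop k] with A hA
  have hAk0 : ((A - k : ℕ) : ℝ) ≠ 0 := Nat.cast_ne_zero.2 (by omega)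
  rw [div_mul_div_comm, mul_comm ((A - k : ℕ) : ℝ) (A : ℝ), mul_div_mul_right _ _ hAk0, sub_div]

/-! ## §2 The confined Cardy-order lower bound CL from PL, SEP and APL -/

/-- **CL from PL + SEP + APL.** If `c·p₂(M, 3b+2) ≤ f(M + k(3b+2), b)` for `b ≥ b₀`, `M ≥ 1` (end separation,
`c > 0`, `k ≥ 1`), `e^{−C·A} ≤ f(A(3b+2), b)` for `A ≥ 1`, `b ≥ 2` (a-priori bound) and `e^{−G(A)} ≤ p₂(A·n, n)`
eventually in `n` with `G(A)/A → 2π` (plain Cardy-order lower bound), then there is `G'` with `G'(A)/A → 2π` and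
`e^{−G'(A)} ≤ f(A(3b+2), b)` eventually in `b`, for every `A ≥ 1`
(`G'(A) = C·A` for `A ≤ k`, `G'(A) = G(A−k) − log c` for `A > k`). [cite: Nolin2008, §4] -/
theorem ksp_confinedLower_of_sep_plain (f : ℕ → ℕ → ℝ)
    (hSEP : ∃ c : ℝ, 0 < c ∧ ∃ b₀ k : ℕ, 1 ≤ k ∧ ∀ b : ℕ, b₀ ≤ b → ∀ M : ℕ, 1 ≤ M →
      c * pTwo M (3 * b + 2) ≤ f (M + k * (3 * b + 2)) b)
    (hAPL : ∃ C : ℝ, 0 < C ∧ ∀ A b : ℕ, 1 ≤ A → 2 ≤ b → Real.exp (-(C * A)) ≤ f (A * (3 * b + 2)) b)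
    (hPL : ∃ G : ℕ → ℝ, Tendsto (fun A : ℕ ↦ G A / A) atTop (𝓝 (2 * Real.pi)) ∧
      ∀ A : ℕ, 1 ≤ A → ∀ᶠ n : ℕ in atTop, Real.exp (-G A) ≤ pTwo (A * n) n) :
    ∃ G : ℕ → ℝ, Tendsto (fun A : ℕ ↦ G A / A) atTop (𝓝 (2 * Real.pi)) ∧
      ∀ A : ℕ, 1 ≤ A → ∀ᶠ b : ℕ in atTop, Real.exp (-G A) ≤ f (A * (3 * b + 2)) b := by
  obtain ⟨c, hc, b₀, k, _, hsep⟩ := hSEP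
  obtain ⟨C, _, hapl⟩ := hAPL
  obtain ⟨G, hG, hlow⟩ := hPL
  refine ⟨fun A ↦ if A ≤ k then C * A else G (A - k) - Real.log c, ?_, fun A hA ↦ ?_⟩
  · refine (ksp_tendsto_shift_div hG k (Real.log c)).congr' ?_
    filter_upwards [eventually_gt_atTop k] with A hA
    rw [if_neg (not_le.mpr hA)]
  · rcases le_or_gt A k with hAk | hAk
    · filter_upwards [eventually_ge_atTop 2] with b hb
      rw [if_pos hAk]
      exact hapl A b hA hb
    · have hA' : 1 ≤ A - k := by omega
      have h3 : Tendsto (fun b : ℕ ↦ 3 * b + 2) atTop atTop :=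
        tendsto_atTop_mono (fun b : ℕ ↦ (by omega : b ≤ 3 * b + 2)) tendsto_id
      filter_upwards [h3.eventually (hlow (A - k) hA'), eventually_ge_atTop b₀] with b hbn hb
      rw [if_neg (not_le.mpr hAk)]
      have hM : 1 ≤ (A - k) * (3 * b + 2) := le_trans hA' (Nat.le_mul_of_pos_right _ (by omega))
      have hs := hsep b hb ((A - k) * (3 * b + 2)) hM
      have heq : (A - k) * (3 * b + 2) + k * (3 * b + 2) = A * (3 * b + 2) := by
        rw [← Nat.add_mul, Nat.sub_add_cancel hAk.le]
      rw [heq] at hs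
      calc Real.exp (-(G (A - k) - Real.log c)) = c * Real.exp (-G (A - k)) := by
            rw [neg_sub, Real.exp_sub, Real.exp_log hc, Real.exp_neg, div_eq_mul_inv]
        _ ≤ c * pTwo ((A - k) * (3 * b + 2)) (3 * b + 2) := mul_le_mul_of_nonneg_left hbn hc.le
        _ ≤ f (A * (3 * b + 2)) b := hs

/-! ## §3 Registered form -/

/-- **Registered form** (stub `c8_kacTwo_of_sep_plain` of stmt-CriticalPhenomena-13878, lead c8; T6d): with
`f(M,b)` the probability of the end-confined block event on `[0,M]×[0,3b+2]`, MODULO the end-separation hypothesis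
SEP and the a-priori confined lower bound APL, the PLAIN two-sided Cardy-order statement — `p₂(A·n, n) ≤ e^{−g(A)}`
and `e^{−G(A)} ≤ p₂(A·n, n)` eventually in `n`, with `g(A)/A → 2π`, `G(A)/A → 2π` — implies the Kac limit
`n·γ₂(n) → 2π` for EVERY family `γ₂` of two-cluster rates in transfer-matrix order (CL by
`ksp_confinedLower_of_sep_plain`, then lead c6's order transfer `tendsto_nMul_rateTwo_of_cardyOrderTwo`).
[cite: Cardy1998, eq. (bb)] -/
theorem c8_kacTwo_of_sep_plain : ∀ f : ℕ → ℕ → ℝ, f = (fun M b : ℕ => (bondPercolation (zdGraph 2) half).real ((openCrossing {z ∈ (rectangle M (3 * b + 2) : Set (Site 2)) | (z 0 ≤ (b : ℤ) ∨ (M : ℤ) ≤ z 0 + b) → z 1 ≤ (b : ℤ)} (leftSide M (3 * b + 2) : Set (Site 2)) (rightSide M (3 * b + 2) : Set (Site 2)) ∩ tbCrossing b b ∩ openCrossing {z ∈ (rectangle M (3 * b + 2) : Set (Site 2)) | (z 0 ≤ (b : ℤ) ∨ (M : ℤ) ≤ z 0 + b) → 2 * (b : ℤ) + 2 ≤ z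 1} (leftSide M (3 * b + 2) : Set (Site 2)) (rightSide M (3 * b + 2) : Set (Site 2)) ∩ (BondConfig.relabel (sym2Equiv (Site.shift (-pt 0 (2 * (b : ℤ) + 2))))) ⁻¹' tbCrossing b b) ∩ (dualConfig ⁻¹' openCrossing {z ∈ ((· + pt (-1) 0) '' (rectangle (M + 1) (3 * b + 1) : Set (Site 2))) | (z 0 ≤ (b : ℤ) ∨ (M : ℤ) ≤ z 0 + b) → (b : ℤ) + 1 ≤ z 1 ∧ z 1 ≤ 2 * (b : ℤ)} ((· + pt (-1) 0) '' (leftSide (M + 1) (3 * b + 1) : Set (Site 2))) ((· + pt (-1) 0) '' (rightSide (M + 1) (3 * b + 1) : Set (Site 2)))))) →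
    (∃ c : ℝ, 0 < c ∧ ∃ b₀ k : ℕ, 1 ≤ k ∧ ∀ b : ℕ, b₀ ≤ b → ∀ M : ℕ, 1 ≤ M → c * pTwo M (3 * b + 2) ≤ f (M + k * (3 * b + 2)) b) →
    (∃ C : ℝ, 0 < C ∧ ∀ A b : ℕ, 1 ≤ A → 2 ≤ b → Real.exp (-(C * A)) ≤ f (A * (3 * b + 2)) b) →
    (∃ g : ℕ → ℝ, Tendsto (fun A : ℕ ↦ g A / A) atTop (𝓝 (2 * Real.pi)) ∧ ∀ A : ℕ, 1 ≤ A → ∀ᶠ n : ℕ in atTop, pTwo (A * n) n ≤ Real.exp (-g A)) →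
    (∃ G : ℕ → ℝ, Tendsto (fun A : ℕ ↦ G A / A) atTop (𝓝 (2 * Real.pi)) ∧ ∀ A : ℕ, 1 ≤ A → ∀ᶠ n : ℕ in atTop, Real.exp (-G A) ≤ pTwo (A * n) n) →
    ∀ γ₂ : ℕ → ℝ, (∀ n : ℕ, 1 ≤ n → Tendsto (rateSeqTwo n) atTop (𝓝 (γ₂ n))) →
    Tendsto (fun n : ℕ ↦ (n : ℝ) * γ₂ n) atTop (𝓝 (2 * Real.pi)) := by
  intro f hf hSEP hAPL hPU hPL γ₂ h₂
  obtain ⟨G, hG, hlowf⟩ := ksp_confinedLower_of_sep_plain f hSEP hAPL hPL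
  subst hf
  exact tendsto_nMul_rateTwo_of_cardyOrderTwo ⟨hPU, G, hG, hlowf⟩ γ₂ h₂

end Summit.CriticalPhenomena.CardyFormulaZ2.Cruxes.StripClusterRates.TwoClusterRateIsStationaryGap

end
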